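import Mathlib
import Summits.ValiantsHypothesis.ValiantsHypothesis.Theorems.ValuativeGCTValuativeFlipTschirnhausSeeds
import Summits.ValiantsHypothesis.ValiantsHypothesis.Theorems.ValuativeGCTValuativeFlipPaddedPerPencil
import Summits.ValiantsHypothesis.ValiantsHypothesis.Theorems.ValuativeGCTValuativeFlipSeedCriterion
import Summits.ValiantsHypothesis.ValiantsHypothesis.Theorems.ValuativeGCTValuativeFlipSemigroupFloor

/-!
# Explicit two-row seeds on the padded permanent: `n - 1` algebraically independent highest-weight
# vectors of one weight in `ℂ[Δ_m(X₀₀^{m-n} per_n)]`, and polynomial growth of its multiplicities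
(explicit highest-weight-vector axis of `stub_seedRichness`, line `big-cell-semigroup-floor`, crux
`ValuativeGCT.ValuativeFlip`, stmt-ValiantsHypothesis-12624; wall-breaker k1)

THE RESULT (`paddedPer_twoRowSeeds`).  For `2 ≤ n ≤ m` the coordinate ring of the orbit closure of the
padded permanent `pp = X₀₀^{m-n} per_n ∈ Sym^m ℂ^{m²}` contains `n - 1` ALGEBRAICALLY INDEPENDENT
highest-weight vectors of the common weight `ν = -((m-1)·n!) ε_x - n! ε_y` (`x, y` the last two letters
of `MatIdx m`; `ν` is the dual weight of the two-row partition `n!·(m-1, 1)`): the classes of the powers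
`F_r^{n!/r}`, `2 ≤ r ≤ n`, of the Tschirnhaus seeds `F_r` of `…TschirnhausSeeds`.  This is
`stub_seedRichness` of line `big-cell-semigroup-floor` with the richness `n⁴/4` replaced by `n - 2`
— the first explicit, certified per-side seed family in the tree; by the landed engine `semigroupFloor`
it gives the polynomial lower bound `mult_{k ν} ℂ[Δ_m(X₀₀^{m-n} per_n)] ≥ C(k + n - 2, n - 2)` along an
explicit Kadish–Landsberg ray (`paddedPer_orbitMultiplicity_ge`).

THE PROOF.  Evaluate the seeds on the diagonal pencil `P · pp = X_x^{m-n} ∏_t (X_x + a_t X_y)` of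
`…PaddedPerPencil` (a family of points of `End(W) · pp` parametrised by `A = ℂ[a_t]`): the value of
`F_r` is the abstract Tschirnhaus polynomial `G_r(e_1, …, e_r) = m^r e_r + (polynomial in e_1, …, e_{r-1})`
in the elementary symmetric polynomials `e_j(a)` (`pp_seed_value`), a TRIANGULAR family
(`pp_G_triangular`) in the algebraically independent `e_j` (`pp_esymm_algebraicIndependent`, Mathlib's
fundamental theorem of symmetric polynomials); the seed criterion `algebraicIndependent_mk_of_genericOrbitMap`
transports this to `ℂ[Δ_m(pp)]`, `algebraicIndependent_pow` to the powers, and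
`ts_mk_tschPoly_mem_highestWeightSpace` supplies the weights.

AXIS VERDICT (details in the seat's `AXIS.md`, attached to the item as evidence): two-row shapes carry transcendence degree exactly
`n` on the per side (`P_{m,2}` = padded binary forms, complexity `n - 1`), so explicit two-row calculus
certifies richness `Θ(n)` and no more; the stub's `n⁴/4` lives on shapes with `≥ 0.29 n²` rows evaluated
at NON-split sections of `per_n`, where no evaluation formula for tableau highest-weight vectors is known.

No definitions and no notation.
-/

set_option linter.dupNamespace false

namespace Summit.ValiantsHypothesis.ValiantsHypothesis.Theorems.ValuativeFlip

open MvPolynomial Literature.NumberTheory.DiophantineGeometry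
open Literature.Computability.AlgebraicComplexity
open scoped BigOperators

noncomputable section

/-! ## The last two letters of `MatIdx m` -/

/-- For `m ≥ 2`, `x = (m-1, m-1)` is the top letter of `MatIdx m` and `y = (m-1, m-2)` its predecessor
in the lexicographic order. [folklore] -/
theorem pp_letters (m : ℕ) [NeZero m] (hm : 2 ≤ m) :
    (toLex (⟨m - 1, Nat.sub_one_lt (NeZero.ne m)⟩, ⟨m - 2, Nat.sub_lt (NeZero.pos m) Nat.zero_lt_two⟩) : MatIdx m) < (toLex (⟨m - 1, Nat.sub_one_lt (NeZero.ne m)⟩, ⟨m - 1, Nat.sub_one_lt (NeZero.ne m)⟩) : MatIdx m) ∧ (∀ i : MatIdx m, i ≤ (toLex (⟨m - 1, Nat.sub_one_lt (NeZero.ne m)⟩, ⟨m - 1, Nat.sub_one_lt (NeZero.ne m)⟩) : MatIdx m)) ∧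
      (∀ i : MatIdx m, i < (toLex (⟨m - 1, Nat.sub_one_lt (NeZero.ne m)⟩, ⟨m - 1, Nat.sub_one_lt (NeZero.ne m)⟩) : MatIdx m) → i ≤ (toLex (⟨m - 1, Nat.sub_one_lt (NeZero.ne m)⟩, ⟨m - 2, Nat.sub_lt (NeZero.pos m) Nat.zero_lt_two⟩) : MatIdx m)) := by
  refine ⟨?_, ?_, ?_⟩
  · rw [Prod.Lex.toLex_lt_toLex]
    right
    exact ⟨rfl, Fin.mk_lt_mk.mpr (by omega)⟩
  · intro i
    rw [← toLex_ofLex i, Prod.Lex.toLex_le_toLex]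
    rcases lt_or_eq_of_le (show ((ofLex i).1 : ℕ) ≤ m - 1 from by have := (ofLex i).1.2; omega) with h | h
    · left; exact Fin.lt_def.mpr h
    · right
      refine ⟨Fin.ext h, Fin.le_def.mpr ?_⟩
      have := (ofLex i).2.2
      dsimp only
      omega
  · intro i hi
    rw [← toLex_ofLex i, Prod.Lex.toLex_lt_toLex] at hi
    rw [← toLex_ofLex i, Prod.Lex.toLex_le_toLex]
    rcases hi with h | ⟨h1, h2⟩
    · left; exact h
    · right
      refine ⟨h1, Fin.le_def.mpr ?_⟩
      have h2' := Fin.lt_def.mp h2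
      dsimp only at h2' ⊢
      omega

/-! ## The abstract Tschirnhaus polynomials form a triangular family -/

/-- **Triangularity.** The abstract Tschirnhaus polynomial
`G_r = C(m,r)(-X₀)^r + ∑_{i<r} C(m-i-1, r-i-1) m^{i+1} (-X₀)^{r-i-1} X_i` (in variables `X_0, …, X_{n-1}`
standing for `e_1, …, e_n`) is `m^r X_{r-1} +` (a polynomial in `X_j`, `j < r - 1`) for `2 ≤ r ≤ n`; with
`X_0` in place of the vanishing `G_1`, the family indexed by `t = r - 1 ∈ Fin n` is triangular in the sense
of `algebraicIndependent_of_triangular`. [folklore] -/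
theorem pp_G_triangular (n m : ℕ) (hn : 2 ≤ n) (hm : m ≠ 0) (t : Fin n) :
    ∃ c : ℂ, c ≠ 0 ∧ (if (t : ℕ) = 0 then (X t : MvPolynomial (Fin n) ℂ) else (C ((Nat.choose m ((t : ℕ) + 1) : ℕ) : ℂ) * (-X (⟨0, lt_of_lt_of_le Nat.zero_lt_two hn⟩ : Fin n)) ^ ((t : ℕ) + 1) + ∑ i ∈ Finset.range ((t : ℕ) + 1), C ((Nat.choose (m - (i + 1)) (((t : ℕ) + 1) - (i + 1)) * m ^ (i + 1) : ℕ) : ℂ) * ((-X (⟨0, lt_of_lt_of_le Nat.zero_lt_two hn⟩ : Fin n)) ^ (((t : ℕ) + 1) - (i + 1)) * X (⟨min i (n - 1), lt_of_le_of_lt (min_le_right i (n - 1)) (Nat.sub_lt (lt_of_lt_of_le Nat.zero_lt_two hn) Nat.one_pos)⟩ : Fin n)))) -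
      C c * X t ∈ supported ℂ {j : Fin n | j < t} := by
  by_cases ht : (t : ℕ) = 0
  · refine ⟨1, one_ne_zero, ?_⟩
    rw [if_pos ht, C_1, one_mul, sub_self]
    exact Subalgebra.zero_mem _
  · refine ⟨((m ^ ((t : ℕ) + 1) : ℕ) : ℂ), by exact_mod_cast pow_ne_zero _ hm, ?_⟩
    rw [if_neg ht, Finset.sum_range_succ]
    -- the last term of the sum is exactly `m^{t+1} X_t`
    have hlast : C ((Nat.choose (m - ((t : ℕ) + 1)) (((t : ℕ) + 1) - ((t : ℕ) + 1)) * m ^ ((t : ℕ) + 1) : ℕ) : ℂ) *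
        ((-X (⟨0, lt_of_lt_of_le Nat.zero_lt_two hn⟩ : Fin n)) ^ (((t : ℕ) + 1) - ((t : ℕ) + 1)) * X (⟨min ((t : ℕ)) (n - 1), lt_of_le_of_lt (min_le_right ((t : ℕ)) (n - 1)) (Nat.sub_lt (lt_of_lt_of_le Nat.zero_lt_two hn) Nat.one_pos)⟩ : Fin n)) =
        C ((m ^ ((t : ℕ) + 1) : ℕ) : ℂ) * (X t : MvPolynomial (Fin n) ℂ) := by
      have hidx : (⟨min ((t : ℕ)) (n - 1), lt_of_le_of_lt (min_le_right ((t : ℕ)) (n - 1)) (Nat.sub_lt (lt_of_lt_of_le Nat.zero_lt_two hn) Nat.one_pos)⟩ : Fin n) = t := by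
        apply Fin.ext
        dsimp only
        have := t.2
        omega
      rw [hidx, Nat.sub_self, Nat.choose_zero_right, one_mul, pow_zero, one_mul]
    rw [hlast, ← add_assoc, add_sub_cancel_right]
    -- the remaining terms only involve `X_0` and `X_i`, `i < t`
    have h0 : (X (⟨0, lt_of_lt_of_le Nat.zero_lt_two hn⟩ : Fin n) : MvPolynomial (Fin n) ℂ) ∈ supported ℂ {j : Fin n | j < t} := by
      rw [X_mem_supported]
      show (⟨0, _⟩ : Fin n) < t
      rw [Fin.lt_def]
      dsimp only
      omega
    refine Subalgebra.add_mem _ (Subalgebra.mul_mem _ (Subalgebra.algebraMap_mem _ _)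
      (Subalgebra.pow_mem _ (Subalgebra.neg_mem _ h0) _)) (Subalgebra.sum_mem _ fun i hi => ?_)
    rw [Finset.mem_range] at hi
    refine Subalgebra.mul_mem _ (Subalgebra.algebraMap_mem _ _) (Subalgebra.mul_mem _
      (Subalgebra.pow_mem _ (Subalgebra.neg_mem _ h0) _) ?_)
    rw [X_mem_supported]
    show (⟨min i (n - 1), _⟩ : Fin n) < t
    rw [Fin.lt_def]
    dsimp only
    omega

/-- **The elementary symmetric polynomials `e_1, …, e_n` in the `n` block variables are algebraically
independent** (Mathlib's fundamental theorem of symmetric polynomials, `esymmAlgHom_injective`).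
[folklore] -/
theorem pp_esymm_algebraicIndependent (n m : ℕ) (hnm : n ≤ m) :
    AlgebraicIndependent ℂ (fun t : Fin n => MvPolynomial.esymm (BlockIdx n m) ℂ ((t : ℕ) + 1)) := by
  rw [algebraicIndependent_iff_injective_aeval]
  have hcard : n ≤ Fintype.card (BlockIdx n m) := by rw [card_blockIdx hnm]
  intro p q hpq
  apply MvPolynomial.esymmAlgHom_injective ℂ hcard
  apply Subtype.ext
  rw [MvPolynomial.esymmAlgHom_apply, MvPolynomial.esymmAlgHom_apply]
  exact hpq

/-! ## Values of the seeds on the pencil -/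

/-- **The value of the seed `F_r` on the diagonal pencil** `P · pp = X_x^{m-n} ∏_t (X_x + a_t X_y)` is the
abstract Tschirnhaus polynomial `G_r` evaluated at the elementary symmetric polynomials
`e_1(a), …, e_n(a)` (the binary coefficients of the pencil are `α_j = e_j`, `α₀ = 1`). [folklore] -/
theorem pp_seed_value (n m : ℕ) [NeZero m] (hn : 2 ≤ n) (hnm : n ≤ m) {r : ℕ} (hr : r ≤ n) :
    aeval (fun d : DegIdx (MatIdx m) m => coeff d.1 ((X (toLex (⟨m - 1, Nat.sub_one_lt (NeZero.ne m)⟩, ⟨m - 1, Nat.sub_one_lt (NeZero.ne m)⟩) : MatIdx m) : MvPolynomial (MatIdx m) (MvPolynomial (BlockIdx n m) ℂ)) ^ (m - n) * (∏ t : BlockIdx n m, ((X (toLex (⟨m - 1, Nat.sub_one_lt (NeZero.ne m)⟩, ⟨m - 1, Nat.sub_one_lt (NeZero.ne m)⟩) : MatIdx m) : MvPolynomial (MatIdx m) (MvPolynomial (BlockIdx n m) ℂ)) + C (X t : (MvPolynomial (BlockIdx n m) ℂ)) * (X (toLex (⟨m - 1, Nat.sub_one_lt (NeZero.ne m)⟩,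 ⟨m - 2, Nat.sub_lt (NeZero.pos m) Nat.zero_lt_two⟩) : MatIdx m) : MvPolynomial (MatIdx m) (MvPolynomial (BlockIdx n m) ℂ)))))) (C ((Nat.choose m r : ℕ) : ℂ) * (-X (⟨Finsupp.single (toLex (⟨m - 1, Nat.sub_one_lt (NeZero.ne m)⟩, ⟨m - 2, Nat.sub_lt (NeZero.pos m) Nat.zero_lt_two⟩) : MatIdx m) (min 1 m) + Finsupp.single (toLex (⟨m - 1, Nat.sub_one_lt (NeZero.ne m)⟩, ⟨m - 1, Nat.sub_one_lt (NeZero.ne m)⟩) : MatIdx m) (m - min 1 m), ts_deg_mem (toLex (⟨m - 1, Nat.sub_one_lt (NeZero.ne m)⟩, ⟨m - 1, Nat.sub_one_lt (NeZero.ne m)⟩) : MatIdx m) (toLex (⟨m - 1, Nat.sub_one_lt (NeZero.ne m)⟩, ⟨m - 2, Nat.sub_lt (NeZero.pos m) Nat.zero_lt_two⟩) : MatIdx m) m 1⟩ : DegIdx (MatIdx m) m)) ^ r + ∑ i ∈ Finset.range r, C ((Nat.choose (m - (i + 1)) (r - (i + 1)) * m ^ (i + 1) : ℕ) : ℂ)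 * ((-X (⟨Finsupp.single (toLex (⟨m - 1, Nat.sub_one_lt (NeZero.ne m)⟩, ⟨m - 2, Nat.sub_lt (NeZero.pos m) Nat.zero_lt_two⟩) : MatIdx m) (min 1 m) + Finsupp.single (toLex (⟨m - 1, Nat.sub_one_lt (NeZero.ne m)⟩, ⟨m - 1, Nat.sub_one_lt (NeZero.ne m)⟩) : MatIdx m) (m - min 1 m), ts_deg_mem (toLex (⟨m - 1, Nat.sub_one_lt (NeZero.ne m)⟩, ⟨m - 1, Nat.sub_one_lt (NeZero.ne m)⟩) : MatIdx m) (toLex (⟨m - 1, Nat.sub_one_lt (NeZero.ne m)⟩, ⟨m - 2, Nat.sub_lt (NeZero.pos m) Nat.zero_lt_two⟩) : MatIdx m) m 1⟩ : DegIdx (MatIdx m) m)) ^ (r - (i + 1)) * X (⟨Finsupp.single (toLex (⟨m - 1, Nat.sub_one_lt (NeZero.ne m)⟩, ⟨m - 2, Nat.sub_lt (NeZero.pos m) Nat.zero_lt_two⟩) : MatIdx m) (min 0 m) + Finsupp.single (toLex (⟨m - 1, Nat.sub_one_lt (NeZero.ne m)⟩, ⟨m - 1, Nat.sub_one_lt (NeZero.ne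 m)⟩) : MatIdx m) (m - min 0 m), ts_deg_mem (toLex (⟨m - 1, Nat.sub_one_lt (NeZero.ne m)⟩, ⟨m - 1, Nat.sub_one_lt (NeZero.ne m)⟩) : MatIdx m) (toLex (⟨m - 1, Nat.sub_one_lt (NeZero.ne m)⟩, ⟨m - 2, Nat.sub_lt (NeZero.pos m) Nat.zero_lt_two⟩) : MatIdx m) m 0⟩ : DegIdx (MatIdx m) m) ^ i * X (⟨Finsupp.single (toLex (⟨m - 1, Nat.sub_one_lt (NeZero.ne m)⟩, ⟨m - 2, Nat.sub_lt (NeZero.pos m) Nat.zero_lt_two⟩) : MatIdx m) (min (i + 1) m) + Finsupp.single (toLex (⟨m - 1, Nat.sub_one_lt (NeZero.ne m)⟩, ⟨m - 1, Nat.sub_one_lt (NeZero.ne m)⟩) : MatIdx m) (m - min (i + 1) m), ts_deg_mem (toLex (⟨m - 1, Nat.sub_one_lt (NeZero.ne m)⟩, ⟨m - 1, Nat.sub_one_lt (NeZero.ne m)⟩) : MatIdx m) (toLex (⟨m - 1, Nat.sub_one_lt (NeZero.ne m)⟩, ⟨m - 2, Nat.sub_lt (NeZero.pos m) Nat.zero_lt_two⟩)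 : MatIdx m) m (i + 1)⟩ : DegIdx (MatIdx m) m))) =
      aeval (fun t : Fin n => MvPolynomial.esymm (BlockIdx n m) ℂ ((t : ℕ) + 1)) (C ((Nat.choose m r : ℕ) : ℂ) * (-X (⟨0, lt_of_lt_of_le Nat.zero_lt_two hn⟩ : Fin n)) ^ r + ∑ i ∈ Finset.range r, C ((Nat.choose (m - (i + 1)) (r - (i + 1)) * m ^ (i + 1) : ℕ) : ℂ) * ((-X (⟨0, lt_of_lt_of_le Nat.zero_lt_two hn⟩ : Fin n)) ^ (r - (i + 1)) * X (⟨min i (n - 1), lt_of_le_of_lt (min_le_right i (n - 1)) (Nat.sub_lt (lt_of_lt_of_le Nat.zero_lt_two hn) Nat.one_pos)⟩ : Fin n))) := by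
  have hletters := pp_letters m (le_trans hn hnm)
  have hne : (toLex (⟨m - 1, Nat.sub_one_lt (NeZero.ne m)⟩, ⟨m - 2, Nat.sub_lt (NeZero.pos m) Nat.zero_lt_two⟩) : MatIdx m) ≠ (toLex (⟨m - 1, Nat.sub_one_lt (NeZero.ne m)⟩, ⟨m - 1, Nat.sub_one_lt (NeZero.ne m)⟩) : MatIdx m) := ne_of_lt hletters.1
  -- the coordinates of the pencil form
  have hco : ∀ j : ℕ, j ≤ n → aeval (fun d : DegIdx (MatIdx m) m => coeff d.1 ((X (toLex (⟨m - 1, Nat.sub_one_lt (NeZero.ne m)⟩, ⟨m - 1, Nat.sub_one_lt (NeZero.ne m)⟩) : MatIdx m) : MvPolynomial (MatIdx m) (MvPolynomial (BlockIdx n m) ℂ)) ^ (m - n) * (∏ t : BlockIdx n m, ((X (toLex (⟨m - 1, Nat.sub_one_lt (NeZero.ne m)⟩, ⟨m - 1, Nat.sub_one_lt (NeZero.ne m)⟩) : MatIdx m) : MvPolynomial (MatIdx m) (MvPolynomial (BlockIdx n m) ℂ)) + C (X t : (MvPolynomial (BlockIdx n m) ℂ)) * (X (toLex (⟨m - 1,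 Nat.sub_one_lt (NeZero.ne m)⟩, ⟨m - 2, Nat.sub_lt (NeZero.pos m) Nat.zero_lt_two⟩) : MatIdx m) : MvPolynomial (MatIdx m) (MvPolynomial (BlockIdx n m) ℂ))))))
      (X (⟨Finsupp.single (toLex (⟨m - 1, Nat.sub_one_lt (NeZero.ne m)⟩, ⟨m - 2, Nat.sub_lt (NeZero.pos m) Nat.zero_lt_two⟩) : MatIdx m) (min j m) + Finsupp.single (toLex (⟨m - 1, Nat.sub_one_lt (NeZero.ne m)⟩, ⟨m - 1, Nat.sub_one_lt (NeZero.ne m)⟩) : MatIdx m) (m - min j m),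
        ts_deg_mem (toLex (⟨m - 1, Nat.sub_one_lt (NeZero.ne m)⟩, ⟨m - 1, Nat.sub_one_lt (NeZero.ne m)⟩) : MatIdx m) (toLex (⟨m - 1, Nat.sub_one_lt (NeZero.ne m)⟩, ⟨m - 2, Nat.sub_lt (NeZero.pos m) Nat.zero_lt_two⟩) : MatIdx m) m j⟩ : DegIdx (MatIdx m) m) : MvPolynomial (DegIdx (MatIdx m) m) ℂ) =
      MvPolynomial.esymm (BlockIdx n m) ℂ j := by
    intro j hj
    rw [aeval_X]
    show coeff (Finsupp.single (toLex (⟨m - 1, Nat.sub_one_lt (NeZero.ne m)⟩, ⟨m - 2, Nat.sub_lt (NeZero.pos m) Nat.zero_lt_two⟩) : MatIdx m) (min j m) + Finsupp.single (toLex (⟨m - 1, Nat.sub_one_lt (NeZero.ne m)⟩, ⟨m - 1, Nat.sub_one_lt (NeZero.ne m)⟩) : MatIdx m) (m - min j m)) ((X (toLex (⟨m - 1, Nat.sub_one_lt (NeZero.ne m)⟩, ⟨m - 1, Nat.sub_one_lt (NeZero.ne m)⟩) : MatIdx m) : MvPolynomial (MatIdx m) (MvPolynomial (BlockIdx n m)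 ℂ)) ^ (m - n) * (∏ t : BlockIdx n m, ((X (toLex (⟨m - 1, Nat.sub_one_lt (NeZero.ne m)⟩, ⟨m - 1, Nat.sub_one_lt (NeZero.ne m)⟩) : MatIdx m) : MvPolynomial (MatIdx m) (MvPolynomial (BlockIdx n m) ℂ)) + C (X t : (MvPolynomial (BlockIdx n m) ℂ)) * (X (toLex (⟨m - 1, Nat.sub_one_lt (NeZero.ne m)⟩, ⟨m - 2, Nat.sub_lt (NeZero.pos m) Nat.zero_lt_two⟩) : MatIdx m) : MvPolynomial (MatIdx m) (MvPolynomial (BlockIdx n m) ℂ))))) = _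
    rw [min_eq_left (le_trans hj hnm)]
    exact pp_coeff_pencil n m hnm hne j
  -- the abstract variables
  have hvar0 : aeval (fun t : Fin n => MvPolynomial.esymm (BlockIdx n m) ℂ ((t : ℕ) + 1)) (X (⟨0, lt_of_lt_of_le Nat.zero_lt_two hn⟩ : Fin n) : MvPolynomial (Fin n) ℂ) = MvPolynomial.esymm (BlockIdx n m) ℂ 1 := by
    rw [aeval_X]
  have hvar : ∀ i : ℕ, i < r → aeval (fun t : Fin n => MvPolynomial.esymm (BlockIdx n m) ℂ ((t : ℕ) + 1)) (X (⟨min i (n - 1), lt_of_le_of_lt (min_le_right i (n - 1)) (Nat.sub_lt (lt_of_lt_of_le Nat.zero_lt_two hn) Nat.one_pos)⟩ : Fin n) : MvPolynomial (Fin n) ℂ) =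
      MvPolynomial.esymm (BlockIdx n m) ℂ (i + 1) := by
    intro i hi
    rw [aeval_X]
    show MvPolynomial.esymm (BlockIdx n m) ℂ (min i (n - 1) + 1) = _
    rw [min_eq_left (by omega)]
  simp only [map_add, map_sum, map_mul, map_pow, map_neg, aeval_C]
  rw [hco 1 (by omega), hvar0, add_right_inj]
  refine Finset.sum_congr rfl fun i hi => ?_
  rw [Finset.mem_range] at hi
  rw [hco 0 (Nat.zero_le n), hco (i + 1) (by omega), hvar i hi, MvPolynomial.esymm_zero, one_pow, mul_one]

/-! ## Algebraic independence of the seed values, of the seeds, and of their powers -/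

/-- The values of the seeds `F_2, …, F_n` on the pencil are algebraically independent over `ℂ`
(triangular family in the algebraically independent `e_j`). [folklore] -/
theorem pp_seed_values_algebraicIndependent (n m : ℕ) [NeZero m] (hn : 2 ≤ n) (hnm : n ≤ m) :
    AlgebraicIndependent ℂ fun s : Fin (n - 2 + 1) =>
      aeval (fun d : DegIdx (MatIdx m) m => coeff d.1 ((X (toLex (⟨m - 1, Nat.sub_one_lt (NeZero.ne m)⟩, ⟨m - 1, Nat.sub_one_lt (NeZero.ne m)⟩) : MatIdx m) : MvPolynomial (MatIdx m) (MvPolynomial (BlockIdx n m) ℂ)) ^ (m - n) * (∏ t : BlockIdx n m, ((X (toLex (⟨m - 1, Nat.sub_one_lt (NeZero.ne m)⟩, ⟨m - 1, Nat.sub_one_lt (NeZero.ne m)⟩) : MatIdx m) : MvPolynomial (MatIdx m) (MvPolynomial (BlockIdx n m) ℂ)) + C (X t : (MvPolynomial (BlockIdx n m) ℂ)) * (X (toLex (⟨m - 1, Nat.sub_one_lt (NeZero.ne m)⟩, ⟨m - 2, Nat.sub_lt (NeZero.pos m) Nat.zero_lt_two⟩) : MatIdx m) : MvPolynomial (MatIdx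 m) (MvPolynomial (BlockIdx n m) ℂ)))))) (C ((Nat.choose m ((s : ℕ) + 2) : ℕ) : ℂ) * (-X (⟨Finsupp.single (toLex (⟨m - 1, Nat.sub_one_lt (NeZero.ne m)⟩, ⟨m - 2, Nat.sub_lt (NeZero.pos m) Nat.zero_lt_two⟩) : MatIdx m) (min 1 m) + Finsupp.single (toLex (⟨m - 1, Nat.sub_one_lt (NeZero.ne m)⟩, ⟨m - 1, Nat.sub_one_lt (NeZero.ne m)⟩) : MatIdx m) (m - min 1 m), ts_deg_mem (toLex (⟨m - 1, Nat.sub_one_lt (NeZero.ne m)⟩, ⟨m - 1, Nat.sub_one_lt (NeZero.ne m)⟩) : MatIdx m) (toLex (⟨m - 1, Nat.sub_one_lt (NeZero.ne m)⟩, ⟨m - 2, Nat.sub_lt (NeZero.pos m) Nat.zero_lt_two⟩) : MatIdx m) m 1⟩ : DegIdx (MatIdx m) m)) ^ ((s : ℕ) + 2) + ∑ i ∈ Finset.range ((s : ℕ) + 2), C ((Nat.choose (m - (i + 1)) (((s : ℕ) + 2) - (i + 1)) * m ^ (i + 1) : ℕ) : ℂ) * ((-X (⟨Finsupp.single (toLex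 (⟨m - 1, Nat.sub_one_lt (NeZero.ne m)⟩, ⟨m - 2, Nat.sub_lt (NeZero.pos m) Nat.zero_lt_two⟩) : MatIdx m) (min 1 m) + Finsupp.single (toLex (⟨m - 1, Nat.sub_one_lt (NeZero.ne m)⟩, ⟨m - 1, Nat.sub_one_lt (NeZero.ne m)⟩) : MatIdx m) (m - min 1 m), ts_deg_mem (toLex (⟨m - 1, Nat.sub_one_lt (NeZero.ne m)⟩, ⟨m - 1, Nat.sub_one_lt (NeZero.ne m)⟩) : MatIdx m) (toLex (⟨m - 1, Nat.sub_one_lt (NeZero.ne m)⟩, ⟨m - 2, Nat.sub_lt (NeZero.pos m) Nat.zero_lt_two⟩) : MatIdx m) m 1⟩ : DegIdx (MatIdx m) m)) ^ (((s : ℕ) + 2) - (i + 1)) * X (⟨Finsupp.single (toLex (⟨m - 1, Nat.sub_one_lt (NeZero.ne m)⟩, ⟨m - 2, Nat.sub_lt (NeZero.pos m) Nat.zero_lt_two⟩) : MatIdx m) (min 0 m) + Finsupp.single (toLex (⟨m - 1, Nat.sub_one_lt (NeZero.ne m)⟩, ⟨m - 1, Nat.sub_one_lt (NeZero.ne m)⟩)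 : MatIdx m) (m - min 0 m), ts_deg_mem (toLex (⟨m - 1, Nat.sub_one_lt (NeZero.ne m)⟩, ⟨m - 1, Nat.sub_one_lt (NeZero.ne m)⟩) : MatIdx m) (toLex (⟨m - 1, Nat.sub_one_lt (NeZero.ne m)⟩, ⟨m - 2, Nat.sub_lt (NeZero.pos m) Nat.zero_lt_two⟩) : MatIdx m) m 0⟩ : DegIdx (MatIdx m) m) ^ i * X (⟨Finsupp.single (toLex (⟨m - 1, Nat.sub_one_lt (NeZero.ne m)⟩, ⟨m - 2, Nat.sub_lt (NeZero.pos m) Nat.zero_lt_two⟩) : MatIdx m) (min (i + 1) m) + Finsupp.single (toLex (⟨m - 1, Nat.sub_one_lt (NeZero.ne m)⟩, ⟨m - 1, Nat.sub_one_lt (NeZero.ne m)⟩) : MatIdx m) (m - min (i + 1) m), ts_deg_mem (toLex (⟨m - 1, Nat.sub_one_lt (NeZero.ne m)⟩, ⟨m - 1, Nat.sub_one_lt (NeZero.ne m)⟩) : MatIdx m) (toLex (⟨m - 1, Nat.sub_one_lt (NeZero.ne m)⟩, ⟨m - 2, Nat.sub_lt (NeZero.pos m) Nat.zero_lt_two⟩)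 : MatIdx m) m (i + 1)⟩ : DegIdx (MatIdx m) m))) := by
  have hm : m ≠ 0 := NeZero.ne m
  -- the triangular family `g_t`, `t ∈ Fin n`
  have htri := algebraicIndependent_aeval_of_triangular (pp_esymm_algebraicIndependent n m hnm)
    (fun t : Fin n => if (t : ℕ) = 0 then (X t : MvPolynomial (Fin n) ℂ) else (C ((Nat.choose m ((t : ℕ) + 1) : ℕ) : ℂ) * (-X (⟨0, lt_of_lt_of_le Nat.zero_lt_two hn⟩ : Fin n)) ^ ((t : ℕ) + 1) + ∑ i ∈ Finset.range ((t : ℕ) + 1), C ((Nat.choose (m - (i + 1)) (((t : ℕ) + 1) - (i + 1)) * m ^ (i + 1) : ℕ) : ℂ) * ((-X (⟨0, lt_of_lt_of_le Nat.zero_lt_two hn⟩ : Fin n)) ^ (((t : ℕ) + 1) - (i + 1)) * X (⟨min i (n - 1), lt_of_le_of_lt (min_le_right i (n - 1)) (Nat.sub_lt (lt_of_lt_of_le Nat.zero_lt_two hn) Nat.one_pos)⟩ : Fin n))))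
    (pp_G_triangular n m hn hm)
  -- restrict to `t = s + 1`
  have hι : Function.Injective (fun s : Fin (n - 2 + 1) => (⟨(s : ℕ) + 1, by have := s.2; omega⟩ : Fin n)) := by
    intro s s' h
    apply Fin.ext
    have := congrArg Fin.val h
    dsimp only at this
    omega
  have h2 := htri.comp _ hι
  have hfun : (fun s : Fin (n - 2 + 1) =>
      aeval (fun d : DegIdx (MatIdx m) m => coeff d.1 ((X (toLex (⟨m - 1, Nat.sub_one_lt (NeZero.ne m)⟩, ⟨m - 1, Nat.sub_one_lt (NeZero.ne m)⟩) : MatIdx m) : MvPolynomial (MatIdx m) (MvPolynomial (BlockIdx n m) ℂ)) ^ (m - n) * (∏ t : BlockIdx n m, ((X (toLex (⟨m - 1, Nat.sub_one_lt (NeZero.ne m)⟩, ⟨m - 1, Nat.sub_one_lt (NeZero.ne m)⟩) : MatIdx m) : MvPolynomial (MatIdx m) (MvPolynomial (BlockIdx n m) ℂ)) + C (X t : (MvPolynomial (BlockIdx n m) ℂ)) * (X (toLex (⟨m - 1, Nat.sub_one_lt (NeZero.ne m)⟩, ⟨m - 2, Nat.sub_lt (NeZero.pos m) Nat.zero_lt_two⟩)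 : MatIdx m) : MvPolynomial (MatIdx m) (MvPolynomial (BlockIdx n m) ℂ)))))) (C ((Nat.choose m ((s : ℕ) + 2) : ℕ) : ℂ) * (-X (⟨Finsupp.single (toLex (⟨m - 1, Nat.sub_one_lt (NeZero.ne m)⟩, ⟨m - 2, Nat.sub_lt (NeZero.pos m) Nat.zero_lt_two⟩) : MatIdx m) (min 1 m) + Finsupp.single (toLex (⟨m - 1, Nat.sub_one_lt (NeZero.ne m)⟩, ⟨m - 1, Nat.sub_one_lt (NeZero.ne m)⟩) : MatIdx m) (m - min 1 m), ts_deg_mem (toLex (⟨m - 1, Nat.sub_one_lt (NeZero.ne m)⟩, ⟨m - 1, Nat.sub_one_lt (NeZero.ne m)⟩) : MatIdx m) (toLex (⟨m - 1, Nat.sub_one_lt (NeZero.ne m)⟩, ⟨m - 2, Nat.sub_lt (NeZero.pos m) Nat.zero_lt_two⟩) : MatIdx m) m 1⟩ : DegIdx (MatIdx m) m)) ^ ((s : ℕ) + 2) + ∑ i ∈ Finset.range ((s : ℕ) + 2), C ((Nat.choose (m - (i + 1)) (((s : ℕ) + 2) - (i + 1)) * m ^ (i + 1) : ℕ) : ℂ)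 * ((-X (⟨Finsupp.single (toLex (⟨m - 1, Nat.sub_one_lt (NeZero.ne m)⟩, ⟨m - 2, Nat.sub_lt (NeZero.pos m) Nat.zero_lt_two⟩) : MatIdx m) (min 1 m) + Finsupp.single (toLex (⟨m - 1, Nat.sub_one_lt (NeZero.ne m)⟩, ⟨m - 1, Nat.sub_one_lt (NeZero.ne m)⟩) : MatIdx m) (m - min 1 m), ts_deg_mem (toLex (⟨m - 1, Nat.sub_one_lt (NeZero.ne m)⟩, ⟨m - 1, Nat.sub_one_lt (NeZero.ne m)⟩) : MatIdx m) (toLex (⟨m - 1, Nat.sub_one_lt (NeZero.ne m)⟩, ⟨m - 2, Nat.sub_lt (NeZero.pos m) Nat.zero_lt_two⟩) : MatIdx m) m 1⟩ : DegIdx (MatIdx m) m)) ^ (((s : ℕ) + 2) - (i + 1)) * X (⟨Finsupp.single (toLex (⟨m - 1, Nat.sub_one_lt (NeZero.ne m)⟩, ⟨m - 2, Nat.sub_lt (NeZero.pos m) Nat.zero_lt_two⟩) : MatIdx m) (min 0 m) + Finsupp.single (toLex (⟨m - 1, Nat.sub_one_lt (NeZero.ne m)⟩, ⟨m - 1, Nat.sub_one_lt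 (NeZero.ne m)⟩) : MatIdx m) (m - min 0 m), ts_deg_mem (toLex (⟨m - 1, Nat.sub_one_lt (NeZero.ne m)⟩, ⟨m - 1, Nat.sub_one_lt (NeZero.ne m)⟩) : MatIdx m) (toLex (⟨m - 1, Nat.sub_one_lt (NeZero.ne m)⟩, ⟨m - 2, Nat.sub_lt (NeZero.pos m) Nat.zero_lt_two⟩) : MatIdx m) m 0⟩ : DegIdx (MatIdx m) m) ^ i * X (⟨Finsupp.single (toLex (⟨m - 1, Nat.sub_one_lt (NeZero.ne m)⟩, ⟨m - 2, Nat.sub_lt (NeZero.pos m) Nat.zero_lt_two⟩) : MatIdx m) (min (i + 1) m) + Finsupp.single (toLex (⟨m - 1, Nat.sub_one_lt (NeZero.ne m)⟩, ⟨m - 1, Nat.sub_one_lt (NeZero.ne m)⟩) : MatIdx m) (m - min (i + 1) m), ts_deg_mem (toLex (⟨m - 1, Nat.sub_one_lt (NeZero.ne m)⟩, ⟨m - 1, Nat.sub_one_lt (NeZero.ne m)⟩) : MatIdx m) (toLex (⟨m - 1, Nat.sub_one_lt (NeZero.ne m)⟩, ⟨m - 2, Nat.sub_lt (NeZero.pos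 m) Nat.zero_lt_two⟩) : MatIdx m) m (i + 1)⟩ : DegIdx (MatIdx m) m)))) =
      (fun t : Fin n => aeval (fun t : Fin n => MvPolynomial.esymm (BlockIdx n m) ℂ ((t : ℕ) + 1))
        (if (t : ℕ) = 0 then (X t : MvPolynomial (Fin n) ℂ) else (C ((Nat.choose m ((t : ℕ) + 1) : ℕ) : ℂ) * (-X (⟨0, lt_of_lt_of_le Nat.zero_lt_two hn⟩ : Fin n)) ^ ((t : ℕ) + 1) + ∑ i ∈ Finset.range ((t : ℕ) + 1), C ((Nat.choose (m - (i + 1)) (((t : ℕ) + 1) - (i + 1)) * m ^ (i + 1) : ℕ) : ℂ) * ((-X (⟨0, lt_of_lt_of_le Nat.zero_lt_two hn⟩ : Fin n)) ^ (((t : ℕ) + 1) - (i + 1)) * X (⟨min i (n - 1), lt_of_le_of_lt (min_le_right i (n - 1)) (Nat.sub_lt (lt_of_lt_of_le Nat.zero_lt_two hn) Nat.one_pos)⟩ : Fin n))))) ∘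
        (fun s : Fin (n - 2 + 1) => (⟨(s : ℕ) + 1, by have := s.2; omega⟩ : Fin n)) := by
    funext s
    have hs : (s : ℕ) + 2 ≤ n := by have := s.2; omega
    rw [pp_seed_value n m hn hnm hs]
    simp only [Function.comp_apply]
    rw [if_neg (Nat.succ_ne_zero (s : ℕ))]
  rw [hfun]
  exact h2

/-- **The seeds `F_2, …, F_n` have algebraically independent classes in `ℂ[Δ_m(X₀₀^{m-n} per_n)]`**
(seed criterion `algebraicIndependent_mk_of_genericOrbitMap` on the diagonal pencil). [this axis] -/
theorem pp_seeds_algebraicIndependent (n m : ℕ) [NeZero m] (hn : 2 ≤ n) (hnm : n ≤ m) :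
    AlgebraicIndependent ℂ fun s : Fin (n - 2 + 1) =>
      Ideal.Quotient.mk (orbitVanishingIdeal (paddedPerFormLex ℂ n m) m)
        (C ((Nat.choose m ((s : ℕ) + 2) : ℕ) : ℂ) * (-X (⟨Finsupp.single (toLex (⟨m - 1, Nat.sub_one_lt (NeZero.ne m)⟩, ⟨m - 2, Nat.sub_lt (NeZero.pos m) Nat.zero_lt_two⟩) : MatIdx m) (min 1 m) + Finsupp.single (toLex (⟨m - 1, Nat.sub_one_lt (NeZero.ne m)⟩, ⟨m - 1, Nat.sub_one_lt (NeZero.ne m)⟩) : MatIdx m) (m - min 1 m), ts_deg_mem (toLex (⟨m - 1, Nat.sub_one_lt (NeZero.ne m)⟩, ⟨m - 1, Nat.sub_one_lt (NeZero.ne m)⟩) : MatIdx m) (toLex (⟨m - 1, Nat.sub_one_lt (NeZero.ne m)⟩, ⟨m - 2, Nat.sub_lt (NeZero.pos m) Nat.zero_lt_two⟩) : MatIdx m) m 1⟩ : DegIdx (MatIdx m) m)) ^ ((s : ℕ) + 2) + ∑ i ∈ Finset.range ((s : ℕ) + 2), C ((Nat.choose (m - (i + 1)) (((s : ℕ) +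 2) - (i + 1)) * m ^ (i + 1) : ℕ) : ℂ) * ((-X (⟨Finsupp.single (toLex (⟨m - 1, Nat.sub_one_lt (NeZero.ne m)⟩, ⟨m - 2, Nat.sub_lt (NeZero.pos m) Nat.zero_lt_two⟩) : MatIdx m) (min 1 m) + Finsupp.single (toLex (⟨m - 1, Nat.sub_one_lt (NeZero.ne m)⟩, ⟨m - 1, Nat.sub_one_lt (NeZero.ne m)⟩) : MatIdx m) (m - min 1 m), ts_deg_mem (toLex (⟨m - 1, Nat.sub_one_lt (NeZero.ne m)⟩, ⟨m - 1, Nat.sub_one_lt (NeZero.ne m)⟩) : MatIdx m) (toLex (⟨m - 1, Nat.sub_one_lt (NeZero.ne m)⟩, ⟨m - 2, Nat.sub_lt (NeZero.pos m) Nat.zero_lt_two⟩) : MatIdx m) m 1⟩ : DegIdx (MatIdx m) m)) ^ (((s : ℕ) + 2) - (i + 1)) * X (⟨Finsupp.single (toLex (⟨m - 1, Nat.sub_one_lt (NeZero.ne m)⟩, ⟨m - 2, Nat.sub_lt (NeZero.pos m) Nat.zero_lt_two⟩) : MatIdx m) (min 0 m) + Finsupp.single (toLex (⟨m - 1, Nat.sub_one_lt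 (NeZero.ne m)⟩, ⟨m - 1, Nat.sub_one_lt (NeZero.ne m)⟩) : MatIdx m) (m - min 0 m), ts_deg_mem (toLex (⟨m - 1, Nat.sub_one_lt (NeZero.ne m)⟩, ⟨m - 1, Nat.sub_one_lt (NeZero.ne m)⟩) : MatIdx m) (toLex (⟨m - 1, Nat.sub_one_lt (NeZero.ne m)⟩, ⟨m - 2, Nat.sub_lt (NeZero.pos m) Nat.zero_lt_two⟩) : MatIdx m) m 0⟩ : DegIdx (MatIdx m) m) ^ i * X (⟨Finsupp.single (toLex (⟨m - 1, Nat.sub_one_lt (NeZero.ne m)⟩, ⟨m - 2, Nat.sub_lt (NeZero.pos m) Nat.zero_lt_two⟩) : MatIdx m) (min (i + 1) m) + Finsupp.single (toLex (⟨m - 1, Nat.sub_one_lt (NeZero.ne m)⟩, ⟨m - 1, Nat.sub_one_lt (NeZero.ne m)⟩) : MatIdx m) (m - min (i + 1) m), ts_deg_mem (toLex (⟨m - 1, Nat.sub_one_lt (NeZero.ne m)⟩, ⟨m - 1, Nat.sub_one_lt (NeZero.ne m)⟩) : MatIdx m) (toLex (⟨m - 1, Nat.sub_one_lt (NeZero.ne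 m)⟩, ⟨m - 2, Nat.sub_lt (NeZero.pos m) Nat.zero_lt_two⟩) : MatIdx m) m (i + 1)⟩ : DegIdx (MatIdx m) m))) := by
  have hne : (toLex (⟨m - 1, Nat.sub_one_lt (NeZero.ne m)⟩, ⟨m - 2, Nat.sub_lt (NeZero.pos m) Nat.zero_lt_two⟩) : MatIdx m) ≠ (toLex (⟨m - 1, Nat.sub_one_lt (NeZero.ne m)⟩, ⟨m - 1, Nat.sub_one_lt (NeZero.ne m)⟩) : MatIdx m) := ne_of_lt (pp_letters m (le_trans hn hnm)).1
  have h := pp_seed_values_algebraicIndependent n m hn hnm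
  rw [← pp_linSubst_pencil n m hne] at h
  exact algebraicIndependent_mk_of_genericOrbitMap (paddedPerFormLex ℂ n m) m _ _ h

/-- Scaling the two-row weight: `(N / r) • (-((m-1) r) ε_x - r ε_y) = -((m-1) N) ε_x - N ε_y` for
`r ∣ N`. [folklore] -/
theorem pp_smul_twoRowWeight (m : ℕ) [NeZero m] {r N : ℕ} (hdvd : r ∣ N) :
    (N / r) • (fun i : (MatIdx m) => if i = (toLex (⟨m - 1, Nat.sub_one_lt (NeZero.ne m)⟩, ⟨m - 1, Nat.sub_one_lt (NeZero.ne m)⟩) : MatIdx m) then -(((m - 1) * r : ℕ) : ℤ) else if i = (toLex (⟨m - 1, Nat.sub_one_lt (NeZero.ne m)⟩, ⟨m - 2, Nat.sub_lt (NeZero.pos m) Nat.zero_lt_two⟩) : MatIdx m) then -((r : ℕ) : ℤ) else 0) = (fun i : (MatIdx m) => if i = (toLex (⟨m - 1, Nat.sub_one_lt (NeZero.ne m)⟩, ⟨m - 1, Nat.sub_one_lt (NeZero.ne m)⟩) : MatIdx m) then -(((m - 1) * N : ℕ) : ℤ) else if i = (toLex (⟨m - 1, Nat.sub_one_lt (NeZero.ne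 m)⟩, ⟨m - 2, Nat.sub_lt (NeZero.pos m) Nat.zero_lt_two⟩) : MatIdx m) then -((N : ℕ) : ℤ) else 0) := by
  have h : ((N : ℕ) : ℤ) = ((N / r : ℕ) : ℤ) * ((r : ℕ) : ℤ) := by exact_mod_cast (Nat.div_mul_cancel hdvd).symm
  funext i
  simp only [Pi.smul_apply, nsmul_eq_mul]
  split_ifs
  · rw [Nat.cast_mul, Nat.cast_mul, h]
    ring
  · rw [h]
    ring
  · simp

/-- **Explicit two-row seeds on the padded permanent** (the theorem of this axis).  For `2 ≤ n ≤ m`, the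
classes in `ℂ[Δ_m(X₀₀^{m-n} per_n)]` of the powers `F_r^{n!/r}` (`2 ≤ r ≤ n`) of the Tschirnhaus seeds are
`n - 1` algebraically independent highest-weight vectors of the one weight
`ν = -((m-1)·n!) ε_x - n! ε_y` (dual weight of the two-row partition `n!·(m-1, 1)`). [this axis] -/
theorem paddedPer_twoRowSeeds_explicit (n m : ℕ) [NeZero m] (hn : 2 ≤ n) (hnm : n ≤ m) :
    (∀ s : Fin (n - 2 + 1),
      (Ideal.Quotient.mk (orbitVanishingIdeal (paddedPerFormLex ℂ n m) m)
        (C ((Nat.choose m ((s : ℕ) + 2) : ℕ) : ℂ) * (-X (⟨Finsupp.single (toLex (⟨m - 1, Nat.sub_one_lt (NeZero.ne m)⟩, ⟨m - 2, Nat.sub_lt (NeZero.pos m) Nat.zero_lt_two⟩) : MatIdx m) (min 1 m) + Finsupp.single (toLex (⟨m - 1, Nat.sub_one_lt (NeZero.ne m)⟩, ⟨m - 1, Nat.sub_one_lt (NeZero.ne m)⟩) : MatIdx m) (m - min 1 m), ts_deg_mem (toLex (⟨m - 1, Nat.sub_one_lt (NeZero.ne m)⟩, ⟨m - 1, Nat.sub_one_lt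 (NeZero.ne m)⟩) : MatIdx m) (toLex (⟨m - 1, Nat.sub_one_lt (NeZero.ne m)⟩, ⟨m - 2, Nat.sub_lt (NeZero.pos m) Nat.zero_lt_two⟩) : MatIdx m) m 1⟩ : DegIdx (MatIdx m) m)) ^ ((s : ℕ) + 2) + ∑ i ∈ Finset.range ((s : ℕ) + 2), C ((Nat.choose (m - (i + 1)) (((s : ℕ) + 2) - (i + 1)) * m ^ (i + 1) : ℕ) : ℂ) * ((-X (⟨Finsupp.single (toLex (⟨m - 1, Nat.sub_one_lt (NeZero.ne m)⟩, ⟨m - 2, Nat.sub_lt (NeZero.pos m) Nat.zero_lt_two⟩) : MatIdx m) (min 1 m) + Finsupp.single (toLex (⟨m - 1, Nat.sub_one_lt (NeZero.ne m)⟩, ⟨m - 1, Nat.sub_one_lt (NeZero.ne m)⟩) : MatIdx m) (m - min 1 m), ts_deg_mem (toLex (⟨m - 1, Nat.sub_one_lt (NeZero.ne m)⟩, ⟨m - 1, Nat.sub_one_lt (NeZero.ne m)⟩) : MatIdx m) (toLex (⟨m - 1, Nat.sub_one_lt (NeZero.ne m)⟩, ⟨m - 2, Nat.sub_lt (NeZero.pos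 m) Nat.zero_lt_two⟩) : MatIdx m) m 1⟩ : DegIdx (MatIdx m) m)) ^ (((s : ℕ) + 2) - (i + 1)) * X (⟨Finsupp.single (toLex (⟨m - 1, Nat.sub_one_lt (NeZero.ne m)⟩, ⟨m - 2, Nat.sub_lt (NeZero.pos m) Nat.zero_lt_two⟩) : MatIdx m) (min 0 m) + Finsupp.single (toLex (⟨m - 1, Nat.sub_one_lt (NeZero.ne m)⟩, ⟨m - 1, Nat.sub_one_lt (NeZero.ne m)⟩) : MatIdx m) (m - min 0 m), ts_deg_mem (toLex (⟨m - 1, Nat.sub_one_lt (NeZero.ne m)⟩, ⟨m - 1, Nat.sub_one_lt (NeZero.ne m)⟩) : MatIdx m) (toLex (⟨m - 1, Nat.sub_one_lt (NeZero.ne m)⟩, ⟨m - 2, Nat.sub_lt (NeZero.pos m) Nat.zero_lt_two⟩) : MatIdx m) m 0⟩ : DegIdx (MatIdx m) m) ^ i * X (⟨Finsupp.single (toLex (⟨m - 1, Nat.sub_one_lt (NeZero.ne m)⟩, ⟨m - 2, Nat.sub_lt (NeZero.pos m) Nat.zero_lt_two⟩) : MatIdx m) (min (i + 1) m) + Finsupp.single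 (toLex (⟨m - 1, Nat.sub_one_lt (NeZero.ne m)⟩, ⟨m - 1, Nat.sub_one_lt (NeZero.ne m)⟩) : MatIdx m) (m - min (i + 1) m), ts_deg_mem (toLex (⟨m - 1, Nat.sub_one_lt (NeZero.ne m)⟩, ⟨m - 1, Nat.sub_one_lt (NeZero.ne m)⟩) : MatIdx m) (toLex (⟨m - 1, Nat.sub_one_lt (NeZero.ne m)⟩, ⟨m - 2, Nat.sub_lt (NeZero.pos m) Nat.zero_lt_two⟩) : MatIdx m) m (i + 1)⟩ : DegIdx (MatIdx m) m)))) ^ (n.factorial / ((s : ℕ) + 2)) ∈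
        highestWeightSpace (orbitCoordRep (paddedPerFormLex ℂ n m) m)
          (fun i : (MatIdx m) => if i = (toLex (⟨m - 1, Nat.sub_one_lt (NeZero.ne m)⟩, ⟨m - 1, Nat.sub_one_lt (NeZero.ne m)⟩) : MatIdx m) then -(((m - 1) * (n.factorial) : ℕ) : ℤ) else if i = (toLex (⟨m - 1, Nat.sub_one_lt (NeZero.ne m)⟩, ⟨m - 2, Nat.sub_lt (NeZero.pos m) Nat.zero_lt_two⟩) : MatIdx m) then -(((n.factorial) : ℕ) : ℤ) else 0)) ∧
    AlgebraicIndependent ℂ fun s : Fin (n - 2 + 1) =>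
      (Ideal.Quotient.mk (orbitVanishingIdeal (paddedPerFormLex ℂ n m) m)
        (C ((Nat.choose m ((s : ℕ) + 2) : ℕ) : ℂ) * (-X (⟨Finsupp.single (toLex (⟨m - 1, Nat.sub_one_lt (NeZero.ne m)⟩, ⟨m - 2, Nat.sub_lt (NeZero.pos m) Nat.zero_lt_two⟩) : MatIdx m) (min 1 m) + Finsupp.single (toLex (⟨m - 1, Nat.sub_one_lt (NeZero.ne m)⟩, ⟨m - 1, Nat.sub_one_lt (NeZero.ne m)⟩) : MatIdx m) (m - min 1 m), ts_deg_mem (toLex (⟨m - 1, Nat.sub_one_lt (NeZero.ne m)⟩, ⟨m - 1, Nat.sub_one_lt (NeZero.ne m)⟩) : MatIdx m) (toLex (⟨m - 1, Nat.sub_one_lt (NeZero.ne m)⟩, ⟨m - 2, Nat.sub_lt (NeZero.pos m) Nat.zero_lt_two⟩) : MatIdx m) m 1⟩ : DegIdx (MatIdx m) m)) ^ ((s : ℕ) + 2) + ∑ i ∈ Finset.range ((s : ℕ) + 2), C ((Nat.choose (m - (i + 1)) (((s : ℕ) + 2) - (i + 1)) * m ^ (i + 1) : ℕ) : ℂ)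 * ((-X (⟨Finsupp.single (toLex (⟨m - 1, Nat.sub_one_lt (NeZero.ne m)⟩, ⟨m - 2, Nat.sub_lt (NeZero.pos m) Nat.zero_lt_two⟩) : MatIdx m) (min 1 m) + Finsupp.single (toLex (⟨m - 1, Nat.sub_one_lt (NeZero.ne m)⟩, ⟨m - 1, Nat.sub_one_lt (NeZero.ne m)⟩) : MatIdx m) (m - min 1 m), ts_deg_mem (toLex (⟨m - 1, Nat.sub_one_lt (NeZero.ne m)⟩, ⟨m - 1, Nat.sub_one_lt (NeZero.ne m)⟩) : MatIdx m) (toLex (⟨m - 1, Nat.sub_one_lt (NeZero.ne m)⟩, ⟨m - 2, Nat.sub_lt (NeZero.pos m) Nat.zero_lt_two⟩) : MatIdx m) m 1⟩ : DegIdx (MatIdx m) m)) ^ (((s : ℕ) + 2) - (i + 1)) * X (⟨Finsupp.single (toLex (⟨m - 1, Nat.sub_one_lt (NeZero.ne m)⟩, ⟨m - 2, Nat.sub_lt (NeZero.pos m) Nat.zero_lt_two⟩) : MatIdx m) (min 0 m) + Finsupp.single (toLex (⟨m - 1, Nat.sub_one_lt (NeZero.ne m)⟩, ⟨m - 1, Nat.sub_one_lt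 (NeZero.ne m)⟩) : MatIdx m) (m - min 0 m), ts_deg_mem (toLex (⟨m - 1, Nat.sub_one_lt (NeZero.ne m)⟩, ⟨m - 1, Nat.sub_one_lt (NeZero.ne m)⟩) : MatIdx m) (toLex (⟨m - 1, Nat.sub_one_lt (NeZero.ne m)⟩, ⟨m - 2, Nat.sub_lt (NeZero.pos m) Nat.zero_lt_two⟩) : MatIdx m) m 0⟩ : DegIdx (MatIdx m) m) ^ i * X (⟨Finsupp.single (toLex (⟨m - 1, Nat.sub_one_lt (NeZero.ne m)⟩, ⟨m - 2, Nat.sub_lt (NeZero.pos m) Nat.zero_lt_two⟩) : MatIdx m) (min (i + 1) m) + Finsupp.single (toLex (⟨m - 1, Nat.sub_one_lt (NeZero.ne m)⟩, ⟨m - 1, Nat.sub_one_lt (NeZero.ne m)⟩) : MatIdx m) (m - min (i + 1) m), ts_deg_mem (toLex (⟨m - 1, Nat.sub_one_lt (NeZero.ne m)⟩, ⟨m - 1, Nat.sub_one_lt (NeZero.ne m)⟩) : MatIdx m) (toLex (⟨m - 1, Nat.sub_one_lt (NeZero.ne m)⟩, ⟨m - 2, Nat.sub_lt (NeZero.pos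 m) Nat.zero_lt_two⟩) : MatIdx m) m (i + 1)⟩ : DegIdx (MatIdx m) m)))) ^ (n.factorial / ((s : ℕ) + 2)) := by
  obtain ⟨hlt, htop, hpred⟩ := pp_letters m (le_trans hn hnm)
  have hm1 : 1 ≤ m := le_trans (by omega) (le_trans hn hnm)
  refine ⟨fun s => ?_, ?_⟩
  · have hs : (s : ℕ) + 2 ≤ n := by have := s.2; omega
    have h := ts_mk_tschPoly_mem_highestWeightSpace (K := ℂ) hlt htop hpred hm1
      (show (s : ℕ) + 2 ≤ m from le_trans hs hnm) (paddedPerFormLex ℂ n m) (n.factorial / ((s : ℕ) + 2))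
    rwa [pp_smul_twoRowWeight m (Nat.dvd_factorial (by omega) hs)] at h
  · refine algebraicIndependent_pow (pp_seeds_algebraicIndependent n m hn hnm) _ fun s => ?_
    have hs : (s : ℕ) + 2 ≤ n := by have := s.2; omega
    exact Nat.div_pos (Nat.le_of_dvd (Nat.factorial_pos n) (Nat.dvd_factorial (by omega) hs)) (by omega)

/-- **Two-row seed richness of the padded permanent** — `stub_seedRichness` of line
`big-cell-semigroup-floor` with richness `n - 2` in place of `n⁴/4`: for `2 ≤ n ≤ m` there are a weight
`ν` and `(n - 2) + 1` algebraically independent highest-weight vectors of weight `ν` in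
`ℂ[Δ_m(X₀₀^{m-n} per_n)]`. [this axis] -/
theorem paddedPer_twoRowSeeds (n m : ℕ) [NeZero m] (hn : 2 ≤ n) (hnm : n ≤ m) :
    ∃ (ν : Weight (MatIdx m)) (F : Fin (n - 2 + 1) → OrbitCoordRing (paddedPerFormLex ℂ n m) m),
      (∀ i, F i ∈ highestWeightSpace (orbitCoordRep (paddedPerFormLex ℂ n m) m) ν) ∧
      AlgebraicIndependent ℂ F :=
  ⟨_, _, (paddedPer_twoRowSeeds_explicit n m hn hnm).1, (paddedPer_twoRowSeeds_explicit n m hn hnm).2⟩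

/-- **Polynomial growth of padded-permanent multiplicities along the explicit two-row ray**: for
`2 ≤ n ≤ m` and every `k`, `mult_{k ν} ℂ[Δ_m(X₀₀^{m-n} per_n)] ≥ C(k + n - 2, n - 2)` with
`ν = -((m-1)·n!) ε_x - n! ε_y` (the landed engine `semigroupFloor` run on the explicit seeds). [this axis] -/
theorem paddedPer_orbitMultiplicity_ge (n m : ℕ) [NeZero m] (hn : 2 ≤ n) (hnm : n ≤ m) (k : ℕ) :
    (k + (n - 2)).choose (n - 2) ≤
      orbitMultiplicity ℂ (paddedPerFormLex ℂ n m) m (k • (fun i : (MatIdx m) => if i = (toLex (⟨m - 1, Nat.sub_one_lt (NeZero.ne m)⟩, ⟨m - 1, Nat.sub_one_lt (NeZero.ne m)⟩) : MatIdx m) then -(((m - 1) * (n.factorial) : ℕ) : ℤ) else if i = (toLex (⟨m - 1, Nat.sub_one_lt (NeZero.ne m)⟩, ⟨m - 2, Nat.sub_lt (NeZero.pos m) Nat.zero_lt_two⟩) : MatIdx m) then -(((n.factorial) : ℕ) : ℤ) else 0)) :=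
  semigroupFloor (paddedPerFormLex ℂ n m) (NeZero.ne m) _ (n - 2) _
    (paddedPer_twoRowSeeds_explicit n m hn hnm).1 (paddedPer_twoRowSeeds_explicit n m hn hnm).2 k

end

end Summit.ValiantsHypothesis.ValiantsHypothesis.Theorems.ValuativeFlip
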